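import Summits.Langlands.Langlands.Theorems.SoloInformedGLOneResidualFM
import Literature.NumberTheory.GaloisRepresentations.DeRhamLAdicCharacterHeckeRat
import HarnessLib

/-!
# Λ41 — The repaired `GL₁` summit over `ℚ`, unconditionally

Solo (informed) programme, rung Λ41 — the payoff of Stage C (Λ31–Λ40).  Λ28
(`globalLanglandsCorrespondenceGLnR3plus_one_iff_fm_of_odd_finrank`) showed that over a number field
of odd degree the R3⁺-repaired `n = 1` conjunct of the summit is EQUIVALENT to rank-one Fontaine–Mazur
for that field and THE pinned `p`-adic Hodge datum ("every `ρ : Γ_K → GL₁(ℚ̄_ℓ)` de Rham at every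
`v ∣ ℓ` is a Weil character `r_{θ,ι}`"), i.e. to the `K`-instance of the tree's named fact
`FramedGaloisRep.exists_heckeCharacter_of_isDeRhamFramed` (Patrikis Prop. 2.2.1 / Serre III §2.3 + App. A).
Stage C PROVED that instance for `K = ℚ` in the Literature layer
(`FramedGaloisRep.exists_heckeCharacter_of_isDeRhamFramed_rat`, via Tate's theorem on Hodge–Tate
characters of `ℚ_ℓ` from `B_dR`-periods: Λ31–Λ40).  Hence:

* ★★★ `fontaineMazurOne_rat` — **rank-one Fontaine–Mazur over `ℚ`**: every continuous
  `ρ : Γ_ℚ → GL₁(ℚ̄_ℓ)` that the pinned datum declares de Rham at `ℓ` IS Weil's `r_{θ,ι}` for an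
  algebraic Hecke character `θ` of `ℚ` — no hypothesis;
* ★★★★ `globalLanglandsCorrespondenceGLnR3plus_one_rat` — **the R3⁺-repaired `GL₁` reciprocity
  conjunct `R3plus.GlobalLanglandsCorrespondenceGLnR3plus 1 ℚ 𝓡 hcpt` holds for every reciprocity datum
  `𝓡` of `ℚ` and every compactness witness**, with no named fact and no hypothesis: the first conjunct
  of the (repaired) summit decided outright over the rational field.

Plain theorems; no definitions.

Citations: [FontaineMazurGeometric1995] Conj. 1 and §1; [Patrikis2019] Prop. 2.2.1;
[SerreAbelianLadic1968] Ch. III §2.3 Thm. 2 and App. A; [BuzzardGeeLMS2014] Conj. 3.2.1–3.2.2;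
[Weil1956] §1; [Tate1967] §3.3.
-/

noncomputable section
open scoped MatrixGroups Matrix Classical Polynomial NumberField
open NumberField IsDedekindDomain Field Polynomial Filter
open Literature.NumberTheory.Automorphic Literature.NumberTheory.GaloisRepresentations
open Literature.NumberTheory.PAdicHodge

namespace Summit.Langlands.Langlands.Theorems

namespace GLOneRigidity

section RationalField

variable {hcpt : isCompact_glFiniteIntegralLevel 1 ℚ}

/-- ★★★ **Rank-one Fontaine–Mazur over `ℚ` (pinned datum), unconditionally**: a continuous
`ρ : Γ_ℚ → GL₁(ℚ̄_ℓ)` de Rham at `ℓ` for the pinned Fontaine datum is Weil's `r_{θ,ι}` for an algebraic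
Hecke character `θ` of `ℚ` (Stage C's `FramedGaloisRep.exists_heckeCharacter_of_isDeRhamFramed_rat`
read through rigidity, Λ22 `eq_weilRep_of_eventually_hasFrobCharpolyAt`).
[cite: FontaineMazurGeometric1995, Conj. 1] [cite: Patrikis2019, Prop. 2.2.1]
[cite: SerreAbelianLadic1968, Ch. III §2.3 Thm. 2 and App. A] -/
theorem fontaineMazurOne_rat (𝓡 : ReciprocityData ℚ) {ℓ : ℕ} [Fact ℓ.Prime]
    (ι : PadicAlgCl ℓ ≃+* ℂ) (ρ : FramedGaloisRep ℚ (PadicAlgCl ℓ) 1)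
    (hdR : ∀ (v : HeightOneSpectrum (𝓞 ℚ)) (hv : ((ℓ : ℕ) : 𝓞 ℚ) ∈ v.asIdeal),
      (𝓡.pst ℓ v hv).IsDeRhamFramed (ρ.toLocal v)) :
    ∃ (θ : HeckeCharacter ℚ) (p q : InfinitePlace ℚ → ℤ) (hinf : θ.HasInfinityType p q)
      (T : Finset (HeightOneSpectrum (𝓞 ℚ))) (e : HeightOneSpectrum (𝓞 ℚ) → ℕ)
      (hmod : HeckeCharacter.IsModulus θ T e), ρ = hinf.weilRep hmod ι := by
  obtain ⟨χ, hχ, h⟩ :=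
    FramedGaloisRep.exists_heckeCharacter_of_isDeRhamFramed_rat ℓ ρ (fun v hv => hdR v hv) ι
  obtain ⟨p, q, hinf⟩ := χ.isAlgebraic_iff_exists_hasInfinityType.mp hχ
  obtain ⟨T, e, hmod⟩ := χ.exists_isModulus
  exact ⟨χ, p, q, hinf, T, e, hmod,
    eq_weilRep_of_eventually_hasFrobCharpolyAt ι hinf hmod (h.mono fun v hv => hv.2.2)⟩

/-- ★★★★ **The R3⁺-repaired `GL₁` reciprocity conjunct holds over `ℚ`** — for every reciprocity
datum `𝓡` of `ℚ` and every compactness witness, with no named fact and no hypothesis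
(Λ28 `globalLanglandsCorrespondenceGLnR3plus_one_iff_fm_of_odd_finrank` at `[ℚ : ℚ] = 1`, and
`fontaineMazurOne_rat`). [cite: BuzzardGeeLMS2014, Conj. 3.2.1–3.2.2]
[cite: FontaineMazurGeometric1995, Conj. 1] [cite: Weil1956, §1] [cite: Patrikis2019, Prop. 2.2.1] -/
theorem globalLanglandsCorrespondenceGLnR3plus_one_rat (𝓡 : ReciprocityData ℚ) :
    R3plus.GlobalLanglandsCorrespondenceGLnR3plus 1 ℚ 𝓡 hcpt :=
  (globalLanglandsCorrespondenceGLnR3plus_one_iff_fm_of_odd_finrank (hcpt := hcpt)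
      (by rw [Module.finrank_self]; exact odd_one) 𝓡).mpr
    fun _ _ ι ρ hdR => fontaineMazurOne_rat 𝓡 ι ρ hdR

end RationalField

end GLOneRigidity

end Summit.Langlands.Langlands.Theorems

end
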